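import Literature.Analysis.SpecialFunctions.RiemannThetaTransformationKappa
import Literature.Analysis.SpecialFunctions.RiemannThetaNonvanishing
import Mathlib.LinearAlgebra.Matrix.SpecialLinearGroup
import HarnessLib

/-!
# Binary theta series inside the genus-two Riemann theta function: the symplectic embedding
# `γ ↦ (a, bB; (c/D)·adj B, d)` of `Γ₀(D)` (Hecke 1926; Schoeneberg 1939; Andrianov–Zhuravlev Ch. 1 §3)

Topic `Literature/NumberTheory/ModularForms`; namespace `Literature.NumberTheory.ModularForms.BinaryTheta`.
Everything here is PROVED; the definitions (`symplEmbed`, the point `τ • B` of `𝔥₂`) have bodies; no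
named fact.

Let `B ∈ M₂(ℤ)` be symmetric and positive definite with `D = det B > 0` (the Gram matrix `2Q` of a
positive definite integral binary quadratic form `Q(x) = ½ ᵗxBx`).  The theta series of `Q` with
characteristic, `ϑ_B[a; b](τ) = Σ_{m ∈ ℤ²} e(πi τ ᵗ(m+a)B(m+a) + 2πi ᵗ(m+a)b)`, is the value at
`v = 0`, `Z = τ·B ∈ 𝔥₂` of the tree's genus-two Riemann theta function with characteristics
`riemannThetaChar a b Z v` (`Literature/Analysis/SpecialFunctions/RiemannThetaCharacteristics.lean`).
The classical device for its modularity (Andrianov–Zhuravlev, *Modular Forms and Hecke Operators*,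
Ch. 1 §3.3 "Symplectic transformations of theta-series": the theta series of the quadratic form `Q`
is the restriction of the Siegel theta function to `Z = τQ`, and `γ = (a b; c d)` with `q ∣ c`, `q`
the level, acts through the integral symplectic matrix `(a·1, bQ; cQ⁻¹, d·1)`) is typed here for
`g = 2`:

* `symplEmbed B γ = (a·1₂, b·B; (c/D)·adj B, d·1₂)` for `γ = (a b; c d) ∈ SL₂(ℤ)`;
  `symplEmbed_mem` — it lies in `Sp₄(ℤ)` when `D ∣ c` (`cB⁻¹ = (c/D)·adj B` is then integral);
* `smul_mem_siegelUpperHalfSpace` — `τ·B ∈ 𝔥₂` for `Im τ > 0`;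
* `denom_symplEmbed`, `moeb_symplEmbed` — `γ_M Z + δ = (cτ + d)·1₂` and `M(τ·B) = (γτ)·B` with
  `γτ = (aτ + b)/(cτ + d)`;
* `thetaCharFst_symplEmbed`, `thetaCharSnd_symplEmbed` — the transformed characteristic `M[c]` of the
  tree's `thetaCharFst/Snd` for `M = symplEmbed B γ`:
  `M[c]¹ = d·a - (c/D)·adj B·b + ½(c/D)d·(adj B)₀`, `M[c]² = a'·b - b'·B·a + ½ a'b'(B)₀`;
* `exists_int_thetaChar_symplEmbed_zero` — for `B` with EVEN diagonal, `M[0] ∈ ℤ⁴`, so the theta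
  null `ϑ[0;0](·, τB)` is carried to itself (`riemannThetaChar_symplEmbed_zero`).

These are the inputs of the transformation law of binary theta series under `Γ₀(D)` obtained in the
sequel `BinaryThetaNull.lean` from the tree's genus-`g` Theta Transformation Formula
(`exists_riemannThetaChar_transform`, Lange Thm. 3.3.9 up to the constant, and
`exists_unit_sq_riemannThetaChar_transform_const_eq_mul_det_denom`, `C² = u·det(γZ+δ)`).

## References

* A. N. Andrianov, V. G. Zhuravlev, *Modular Forms and Hecke Operators*, AMS Transl. Math.
  Monogr. 145 (1995; AMS 2015 printing), Ch. 1 §3.3 (Prop. 3.12, Thm. 3.13). [AndrianovZhuravlev2015]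
* E. Hecke, *Zur Theorie der elliptischen Modulfunktionen*, Math. Ann. 97 (1926), §§2–3. [Hecke1926Modulfunktionen]
* B. Schoeneberg, *Das Verhalten von mehrfachen Thetareihen bei Modulsubstitutionen*, Math. Ann. 116
  (1939). [folklore]
* H. Lange, *Abelian Varieties over the Complex Numbers* (2023), §3.3 Thm. 3.3.9. [Lange2023AbelianVarietiesComplex]
-/

noncomputable section

open Matrix Complex

open scoped MatrixGroups

namespace Literature.NumberTheory.ModularForms.BinaryTheta

open Literature.Analysis.SpecialFunctions
open Literature.NumberTheory.Automorphic (siegelUpperHalfSpace mem_siegelUpperHalfSpace_iff)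
open Literature.NumberTheory.ModularForms.SiegelUpperHalfSpace

/-! ### The embedding `Γ₀(D) → Sp₄(ℤ)` attached to `B` -/

/-- **The symplectic embedding attached to an integral symmetric `2 × 2` matrix `B`**:
`γ = (a b; c d) ↦ (a·1₂, b·B; q·adj B, d·1₂)` with `q = c/D`, `D = det B` (integer division; meant
for `D ∣ c`, when `q·adj B = c·B⁻¹`; `adj B = (B₁₁ -B₀₁; -B₁₀ B₀₀)`), written out entrywise.
[cite: AndrianovZhuravlev2015, Ch. 1 §3.3 Prop. 3.12] -/
def symplEmbed (B : Matrix (Fin 2) (Fin 2) ℤ) (γ : SL(2, ℤ)) : Matrix (Fin 2 ⊕ Fin 2) (Fin 2 ⊕ Fin 2) ℤ :=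
  Matrix.fromBlocks !![(γ 0 0 : ℤ), 0; 0, (γ 0 0 : ℤ)]
    !![(γ 0 1 : ℤ) * B 0 0, (γ 0 1 : ℤ) * B 0 1; (γ 0 1 : ℤ) * B 1 0, (γ 0 1 : ℤ) * B 1 1]
    !![(γ 1 0 : ℤ) / B.det * B 1 1, -((γ 1 0 : ℤ) / B.det * B 0 1);
      -((γ 1 0 : ℤ) / B.det * B 1 0), (γ 1 0 : ℤ) / B.det * B 0 0]
    !![(γ 1 1 : ℤ), 0; 0, (γ 1 1 : ℤ)]

/-- `(c/D)·D = c` for `D ∣ c` (also when `D = 0`, forcing `c = 0`), with `D = det B` expanded.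
[folklore] -/
private theorem ediv_det_mul_det_eq {B : Matrix (Fin 2) (Fin 2) ℤ} {γ : SL(2, ℤ)} (hγ : B.det ∣ (γ 1 0 : ℤ)) :
    (γ 1 0 : ℤ) / B.det * (B 0 0 * B 1 1 - B 0 1 * B 1 0) = (γ 1 0 : ℤ) := by
  rw [← Matrix.det_fin_two]; exact Int.ediv_mul_cancel hγ

/-- **`symplEmbed B γ ∈ Sp₄(ℤ)` when `B` is symmetric and `det B ∣ c`** (Andrianov–Zhuravlev Prop. 3.12:
`(a·1, bQ; cQ⁻¹, d·1)` is an integral symplectic matrix for `q ∣ c`).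
[cite: AndrianovZhuravlev2015, Ch. 1 §3.3 Prop. 3.12] -/
theorem symplEmbed_mem {B : Matrix (Fin 2) (Fin 2) ℤ} (hB : B.IsSymm) {γ : SL(2, ℤ)}
    (hγ : B.det ∣ (γ 1 0 : ℤ)) : symplEmbed B γ ∈ Matrix.symplecticGroup (Fin 2) ℤ := by
  have hdet := Matrix.SpecialLinearGroup.det_coe γ
  rw [Matrix.det_fin_two] at hdet
  have hq := ediv_det_mul_det_eq hγ
  have h01 : B 1 0 = B 0 1 := hB.apply 0 1
  rw [h01] at hq
  rw [symplEmbed, SymplecticGroup.fromBlocks_mem_iff, h01]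
  refine ⟨?_, ?_, ?_⟩
  · ext i j
    fin_cases i <;> fin_cases j <;> simp [Matrix.mul_apply, Fin.sum_univ_two] <;> ring
  · ext i j
    fin_cases i <;> fin_cases j <;> simp [Matrix.mul_apply, Fin.sum_univ_two] <;> ring
  · ext i j
    fin_cases i <;> fin_cases j <;> simp [Matrix.mul_apply, Fin.sum_univ_two]
    · linear_combination hdet - (γ 0 1 : ℤ) * hq
    · ring
    · ring
    · linear_combination hdet - (γ 0 1 : ℤ) * hq

/-! ### The point `τ·B` of the Siegel upper half space of genus two -/

/-- **`τ·B ∈ 𝔥₂`** for `Im τ > 0` and `B` symmetric positive definite (as a real matrix).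
[cite: AndrianovZhuravlev2015, Ch. 1 §1.2] -/
theorem smul_mem_siegelUpperHalfSpace {B : Matrix (Fin 2) (Fin 2) ℤ} (hB : B.IsSymm)
    (hpos : (B.map (Int.cast : ℤ → ℝ)).PosDef) {τ : ℂ} (hτ : 0 < τ.im) :
    (τ • B.map (Int.cast : ℤ → ℂ)) ∈ siegelUpperHalfSpace 2 := by
  rw [mem_siegelUpperHalfSpace_iff]
  refine ⟨?_, ?_⟩
  · have h : (B.map (Int.cast : ℤ → ℂ)).IsSymm := hB.map _
    exact h.smul τ
  · have hmap : (τ • B.map (Int.cast : ℤ → ℂ)).map Complex.im = τ.im • B.map (Int.cast : ℤ → ℝ) := by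
      ext i j
      simp [Complex.mul_im]
    rw [hmap]
    exact hpos.smul hτ

/-- The cast blocks of `symplEmbed B γ`. [cite: AndrianovZhuravlev2015, Ch. 1 §3.3 Prop. 3.12] -/
theorem symplEmbed_map_toBlocks (B : Matrix (Fin 2) (Fin 2) ℤ) (γ : SL(2, ℤ)) :
    ((symplEmbed B γ).map ((↑) : ℤ → ℂ)).toBlocks₁₁ = !![((γ 0 0 : ℤ) : ℂ), 0; 0, ((γ 0 0 : ℤ) : ℂ)] ∧
    ((symplEmbed B γ).map ((↑) : ℤ → ℂ)).toBlocks₁₂ =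
      !![((γ 0 1 : ℤ) : ℂ) * ((B 0 0 : ℤ) : ℂ), ((γ 0 1 : ℤ) : ℂ) * ((B 0 1 : ℤ) : ℂ);
        ((γ 0 1 : ℤ) : ℂ) * ((B 1 0 : ℤ) : ℂ), ((γ 0 1 : ℤ) : ℂ) * ((B 1 1 : ℤ) : ℂ)] ∧
    ((symplEmbed B γ).map ((↑) : ℤ → ℂ)).toBlocks₂₁ =
      !![(((γ 1 0 : ℤ) / B.det : ℤ) : ℂ) * ((B 1 1 : ℤ) : ℂ), -((((γ 1 0 : ℤ) / B.det : ℤ) : ℂ) * ((B 0 1 : ℤ) : ℂ));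
        -((((γ 1 0 : ℤ) / B.det : ℤ) : ℂ) * ((B 1 0 : ℤ) : ℂ)), (((γ 1 0 : ℤ) / B.det : ℤ) : ℂ) * ((B 0 0 : ℤ) : ℂ)] ∧
    ((symplEmbed B γ).map ((↑) : ℤ → ℂ)).toBlocks₂₂ = !![((γ 1 1 : ℤ) : ℂ), 0; 0, ((γ 1 1 : ℤ) : ℂ)] := by
  refine ⟨?_, ?_, ?_, ?_⟩ <;> ext i j <;> fin_cases i <;> fin_cases j <;>
    simp [symplEmbed, Matrix.toBlocks₁₁, Matrix.toBlocks₁₂, Matrix.toBlocks₂₁, Matrix.toBlocks₂₂]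

/-- **`γ_M Z + δ = (cτ + d)·1₂`** for `M = symplEmbed B γ`, `Z = τ·B`, `B` symmetric with
`det B ∣ c` (`(c/D)·adj B · τB = cτ·1₂`). [cite: AndrianovZhuravlev2015, Ch. 1 §3.3 Prop. 3.12] -/
theorem denom_symplEmbed {B : Matrix (Fin 2) (Fin 2) ℤ} (hB : B.IsSymm) {γ : SL(2, ℤ)}
    (hγ : B.det ∣ (γ 1 0 : ℤ)) (τ : ℂ) :
    denom ((symplEmbed B γ).map ((↑) : ℤ → ℂ)) (τ • B.map ((↑) : ℤ → ℂ)) =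
      !![((γ 1 0 : ℤ) : ℂ) * τ + ((γ 1 1 : ℤ) : ℂ), 0; 0, ((γ 1 0 : ℤ) : ℂ) * τ + ((γ 1 1 : ℤ) : ℂ)] := by
  obtain ⟨h11, h12, h21, h22⟩ := symplEmbed_map_toBlocks B γ
  have h01 : B 1 0 = B 0 1 := hB.apply 0 1
  have hq : ((((γ 1 0 : ℤ) / B.det : ℤ) : ℂ)) * (((B 0 0 : ℤ) : ℂ) * ((B 1 1 : ℤ) : ℂ) -
      ((B 0 1 : ℤ) : ℂ) * ((B 0 1 : ℤ) : ℂ)) = ((γ 1 0 : ℤ) : ℂ) := by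
    have := ediv_det_mul_det_eq hγ
    rw [h01] at this
    exact_mod_cast this
  rw [denom_def, h21, h22, h01]
  ext i j
  fin_cases i <;> fin_cases j <;>
    simp [Matrix.vecMul, dotProduct, Fin.sum_univ_two, h01, -mul_eq_zero] <;>
    first | linear_combination τ * hq | ring

/-- The numerator: `αZ + β = (aτ + b)·B`. [cite: AndrianovZhuravlev2015, Ch. 1 §3.3 Prop. 3.12] -/
theorem num_symplEmbed (B : Matrix (Fin 2) (Fin 2) ℤ) (γ : SL(2, ℤ)) (τ : ℂ) :
    num ((symplEmbed B γ).map ((↑) : ℤ → ℂ)) (τ • B.map ((↑) : ℤ → ℂ)) =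
      (((γ 0 0 : ℤ) : ℂ) * τ + ((γ 0 1 : ℤ) : ℂ)) • B.map ((↑) : ℤ → ℂ) := by
  obtain ⟨h11, h12, h21, h22⟩ := symplEmbed_map_toBlocks B γ
  rw [num_def, h11, h12]
  ext i j
  fin_cases i <;> fin_cases j <;> simp [Matrix.vecMul, dotProduct, Fin.sum_univ_two] <;> ring

/-- For `Im τ > 0` and `γ = (a b; c d) ∈ SL₂(ℤ)`: `cτ + d ≠ 0` (the automorphy factor is invertible,
the `g = 1` case of Lange Prop. 3.1.6). [cite: Lange2023AbelianVarietiesComplex, §3.1.3 Prop. 3.1.6] -/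
theorem denom_ne_zero (γ : SL(2, ℤ)) {τ : ℂ} (hτ : 0 < τ.im) :
    ((γ 1 0 : ℤ) : ℂ) * τ + ((γ 1 1 : ℤ) : ℂ) ≠ 0 := by
  intro h
  have him : ((((γ 1 0 : ℤ) : ℂ) * τ + ((γ 1 1 : ℤ) : ℂ))).im = 0 := by rw [h]; simp
  simp only [Complex.add_im, Complex.mul_im, Complex.intCast_re, Complex.intCast_im, zero_mul,
    add_zero] at him
  have hc : (γ 1 0 : ℤ) = 0 := by
    rcases mul_eq_zero.mp him with h1 | h1
    · exact_mod_cast h1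
    · exact absurd h1 hτ.ne'
  have hre : ((((γ 1 0 : ℤ) : ℂ) * τ + ((γ 1 1 : ℤ) : ℂ))).re = 0 := by rw [h]; simp
  simp only [hc, Int.cast_zero, zero_mul, zero_add, Complex.intCast_re] at hre
  have hd : (γ 1 1 : ℤ) = 0 := by exact_mod_cast hre
  have hdet := Matrix.SpecialLinearGroup.det_coe γ
  rw [Matrix.det_fin_two, hc, hd] at hdet
  simp at hdet

/-- **`M(τ·B) = (γτ)·B`** with `γτ = (aτ + b)/(cτ + d)`, for `M = symplEmbed B γ`, `B` symmetric,
`det B ∣ c` and `cτ + d ≠ 0`. [cite: AndrianovZhuravlev2015, Ch. 1 §3.3 Prop. 3.12] -/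
theorem moeb_symplEmbed {B : Matrix (Fin 2) (Fin 2) ℤ} (hB : B.IsSymm) {γ : SL(2, ℤ)}
    (hγ : B.det ∣ (γ 1 0 : ℤ)) {τ : ℂ} (hcd : ((γ 1 0 : ℤ) : ℂ) * τ + ((γ 1 1 : ℤ) : ℂ) ≠ 0) :
    moeb ((symplEmbed B γ).map ((↑) : ℤ → ℂ)) (τ • B.map ((↑) : ℤ → ℂ)) =
      ((((γ 0 0 : ℤ) : ℂ) * τ + ((γ 0 1 : ℤ) : ℂ)) / (((γ 1 0 : ℤ) : ℂ) * τ + ((γ 1 1 : ℤ) : ℂ))) •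
        B.map ((↑) : ℤ → ℂ) := by
  set w : ℂ := ((γ 1 0 : ℤ) : ℂ) * τ + ((γ 1 1 : ℤ) : ℂ) with hw
  have h1 : (!![w, 0; 0, w] : Matrix (Fin 2) (Fin 2) ℂ) = w • (1 : Matrix (Fin 2) (Fin 2) ℂ) := by
    ext i j; fin_cases i <;> fin_cases j <;> simp
  have hinv : (w • (1 : Matrix (Fin 2) (Fin 2) ℂ))⁻¹ = w⁻¹ • (1 : Matrix (Fin 2) (Fin 2) ℂ) := by
    refine Matrix.inv_eq_left_inv ?_
    rw [Matrix.smul_mul, Matrix.mul_smul, Matrix.one_mul, smul_smul, inv_mul_cancel₀ hcd, one_smul]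
  rw [moeb_def, denom_symplEmbed hB hγ τ, num_symplEmbed, ← hw, h1, hinv, Matrix.smul_mul,
    Matrix.mul_smul, Matrix.mul_one, smul_smul, div_eq_mul_inv]

/-! ### The transformed characteristic -/

/-- **`M[c]` for `M = symplEmbed B γ`**, first component, with `q = c/D`:
`M[c]¹ = d·a - q·(adj B) b + ½ q d (adj B)₀`. [cite: Lange2023AbelianVarietiesComplex, §3.3.1 Lemma 3.3.1 (b)] -/
theorem thetaCharFst_symplEmbed (B : Matrix (Fin 2) (Fin 2) ℤ) (γ : SL(2, ℤ)) (a b : Fin 2 → ℂ) :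
    thetaCharFst (symplEmbed B γ) a b =
      ![((γ 1 1 : ℤ) : ℂ) * a 0 - (((γ 1 0 : ℤ) / B.det : ℤ) : ℂ) * (((B 1 1 : ℤ) : ℂ) * b 0 - ((B 0 1 : ℤ) : ℂ) * b 1) +
          2⁻¹ * ((((γ 1 0 : ℤ) / B.det * (γ 1 1 : ℤ) * B 1 1 : ℤ)) : ℂ),
        ((γ 1 1 : ℤ) : ℂ) * a 1 - (((γ 1 0 : ℤ) / B.det : ℤ) : ℂ) * (-((B 1 0 : ℤ) : ℂ) * b 0 + ((B 0 0 : ℤ) : ℂ) * b 1) +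
          2⁻¹ * ((((γ 1 0 : ℤ) / B.det * (γ 1 1 : ℤ) * B 0 0 : ℤ)) : ℂ)] := by
  obtain ⟨h11, h12, h21, h22⟩ := symplEmbed_map_toBlocks B γ
  rw [thetaCharFst_def, h21, h22]
  funext i
  fin_cases i <;>
    simp [dotProduct, Fin.sum_univ_two, symplEmbed, Matrix.toBlocks₂₁,
      Matrix.toBlocks₂₂, Matrix.mul_apply] <;> ring

/-- **`M[c]` for `M = symplEmbed B γ`**, second component:
`M[c]² = a'·b - b'·B a + ½ a'b' (B)₀` (`γ = (a' b'; c d)`). [cite: Lange2023AbelianVarietiesComplex, §3.3.1 Lemma 3.3.1 (b)] -/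
theorem thetaCharSnd_symplEmbed (B : Matrix (Fin 2) (Fin 2) ℤ) (γ : SL(2, ℤ)) (a b : Fin 2 → ℂ) :
    thetaCharSnd (symplEmbed B γ) a b =
      ![((γ 0 0 : ℤ) : ℂ) * b 0 - ((γ 0 1 : ℤ) : ℂ) * (((B 0 0 : ℤ) : ℂ) * a 0 + ((B 0 1 : ℤ) : ℂ) * a 1) +
          2⁻¹ * ((((γ 0 0 : ℤ) * (γ 0 1 : ℤ) * B 0 0 : ℤ)) : ℂ),
        ((γ 0 0 : ℤ) : ℂ) * b 1 - ((γ 0 1 : ℤ) : ℂ) * (((B 1 0 : ℤ) : ℂ) * a 0 + ((B 1 1 : ℤ) : ℂ) * a 1) +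
          2⁻¹ * ((((γ 0 0 : ℤ) * (γ 0 1 : ℤ) * B 1 1 : ℤ)) : ℂ)] := by
  obtain ⟨h11, h12, h21, h22⟩ := symplEmbed_map_toBlocks B γ
  rw [thetaCharSnd_def, h11, h12]
  funext i
  fin_cases i <;>
    simp [dotProduct, Fin.sum_univ_two, symplEmbed, Matrix.toBlocks₁₁,
      Matrix.toBlocks₁₂, Matrix.mul_apply] <;> ring

end Literature.NumberTheory.ModularForms.BinaryTheta

end
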